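import Literature.NumberTheory.EllipticCurves.KummerUnramified
import Literature.NumberTheory.GaloisRepresentations.HilbertNinetySubgroup
import HarnessLib

/-!
# Crux `PrintCf2.SplitBadTwoRankOneOfFacts` (stmt-BirchSwinnertonDyer-20368), S3n′-FACT-FREE road, R2 brick B4b (core, μ-FREE):
# an `n`-th root of `a ∈ k` fixed by the inertia group of a prime of `\bar ℤ` forces `n ∣ ord_w(a)` — WITHOUT `μ_n ⊆ k`

Cell `bsd-print-cf2`, EXTRA WIDTH seat `bsd-line-cf2-p1-w3` g13 (prover-bsd-line-cf2-p1-w3-g13-0); `--supports stmt-BirchSwinnertonDyer-20368`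
(helper, Theses-free). HONEST FRAMING: nothing here closes the crux or a registered stub; BSD is not proved by any of this; no summit
statement is proved by this seat. No definition, no named fact, no `sorry`. UNCONDITIONAL; generic (any number field `k`, any Galois
`Ω/k`, any `n`, EVERY finite place `w`).

WHY (memo `R2-BRICKS` (-w5 g7) §3 B4b; `S3N-FACTFREE-w2g14.md` §3/§7). The (PRO-NULL)_U input of the level lift reads the dual Selmer
condition «unramified at the places above `w ∉ S`» in `Γ_K`-internal currency: the Kummer cocycle `τ ↦ τβ/β` (`βⁿ = x ∈ F`) of the
layer field `F = K̄^U` is a coboundary on `U ∩ I(𝔓)` for the primes `𝔓` of `\bar ℤ` above `w`, i.e. (absorbing the coboundary) `x` has an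
`n`-th root fixed by the inertia group of `𝔓` OVER `F`. R1 (p696581) wants «`n ∣ ord_{w′}(x)`» at the place `w′` of `F` below `𝔓`. The
tree's criterion `Literature.NumberTheory.EllipticCurves.dvd_log_valuation_of_inertia_fixes_root` (Silverman VIII.1.6) does exactly this
but ASSUMES `μ_n ⊆ k` (to make `k(α)/k` Galois); the layer fields `K*_n·K_θ` do not contain `μ_{2^M}`. THIS FILE removes the hypothesis:
* `dvd_log_valuation_of_inertia_fixes_root_of_normalClosure` — `k` a number field, `Ω/k` Galois, `αⁿ = a ∈ kˣ` (`α ∈ Ω`, `0 < n`), `𝔓`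
  a prime of the integral closure of `𝓞 k` in `Ω` above `w`; if every element of the inertia group `I_𝔓 ≤ Gal(Ω/k)` fixes `α`, then
  `n ∣ ord_w(a)`;
* `dvd_log_valuation_of_galFixing_inter_inertia_fixes_root` — the `Γ_K`-INTERNAL reading for a finite `F ⊆ K̄` over a number field `K`:
  `𝔓` a prime of `\bar ℤ_K = absIntegers (𝓞 K) K` above the place `w′` of `F` (`𝔓 ∩ 𝓞 F = w′` along `ringOfIntegersToIntegralClosure F`),
  `βⁿ = x ∈ Fˣ` with `β ∈ K̄` fixed by every `τ ∈ Gal(K̄/F) ∩ I_𝔓` (`galFixing K F ⊓ 𝔓.inertia Γ_K`) ⟹ `n ∣ ord_{w′}(x)`.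
Proof (the classical tower argument): `M` = normal closure of `k(α)` in `Ω` (finite Galois), `L = k(α) ⊆ M`, `P = 𝔓 ∩ 𝓞 M`, `Q = P ∩ 𝓞 L`.
Every element of `I(P∣w) ≤ Gal(M/k)` lifts to `I_𝔓` (profinite inertia lifting `exists_mul_mul_mem_inertia`, Serre I §7 Prop. 22 (b)), hence
fixes `α`, hence lies in `Gal(M/L)`: so `I(P∣Q) = I(P∣w)` as sets and `e(P∣Q) = #I(P∣Q) = #I(P∣w) = e(P∣w)`
(`Ideal.card_inertia_eq_ramificationIdxIn` twice); multiplicativity `e(P∣w) = e(Q∣w)·e(P∣Q)` (`Ideal.ramificationIdx_tower`) gives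
`e(Q∣w) = 1`, and `ord_w(a) = ord_Q(a) = n·ord_Q(α)` (`HeightOneSpectrum.valuation_liesOver`).
presearch: Lang, Algebraic Number Theory II §5 / Neukirch ANT II (10.?) «𝔭 ∤ n: K(ⁿ√a)/K unramified at 𝔭 ⟺ …»; the μ-free «only if» at
every place is folklore (inertia field argument); tree twin with `μ_n ⊆ k`: `KummerUnramified`, `KummerUnramifiedDedekind`; no new fact.
beyond-print theorem: no.

References: [SilvermanAEC2009] Prop. VIII.1.6 (proof); [Lang1983] Ch. 6 Prop. 1.3; [SerreLocalFields1979] I §7 Prop. 22 (b); [NeukirchANT1999]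
Ch. I §9.
-/

noncomputable section

set_option linter.dupNamespace false
set_option autoImplicit false

open scoped Pointwise IntermediateField NumberField
open NumberField IsDedekindDomain IntermediateField
open Literature.NumberTheory.EllipticCurves

namespace Summit.BirchSwinnertonDyer.BirchSwinnertonDyer.Theorems.PrintCf2.KummerU

universe u

variable {k : Type u} [Field k] [NumberField k] {Ω : Type u} [Field Ω] [Algebra k Ω] [IsGalois k Ω]

/-- **μ-free unramified Kummer criterion.** Let `k` be a number field, `Ω/k` Galois, `a ∈ kˣ`, `α ∈ Ω` with `αⁿ = a` (`0 < n`), `w` a finite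
place of `k` and `𝔓` a prime of the integral closure of `𝓞 k` in `Ω` above `w`. If every element of the inertia group `I_𝔓 ≤ Gal(Ω/k)` fixes
`α`, then `n ∣ ord_w(a)` — no roots of unity in `k` required. [cite: SilvermanAEC2009, Prop. VIII.1.6 (proof)] [cite: Lang1983, Ch. 6 Prop. 1.3]
[cite: SerreLocalFields1979, I §7 Prop. 22 (b)] -/
theorem dvd_log_valuation_of_inertia_fixes_root_of_normalClosure {n : ℕ} (hn : 0 < n) {a : k}
    {α : Ω} (hα : α ^ n = algebraMap k Ω a) (w : HeightOneSpectrum (𝓞 k))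
    (𝔓 : Ideal (integralClosure (𝓞 k) Ω)) [𝔓.IsPrime] [𝔓.LiesOver w.asIdeal]
    (hI : ∀ σ : Ω ≃ₐ[k] Ω, σ ∈ 𝔓.inertia (Ω ≃ₐ[k] Ω) → σ α = α) :
    (n : ℤ) ∣ WithZero.log (w.valuation k a) := by
  classical
  -- ### the finite Galois extension `M ⊇ k(α)` and the subfield `L = k(α) ⊆ M`
  set L₀ : IntermediateField k Ω := k⟮α⟯ with hL₀
  have hαint : IsIntegral k α := by
    refine IsIntegral.of_pow hn ?_
    rw [hα]
    exact isIntegral_algebraMap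
  haveI : FiniteDimensional k L₀ := IntermediateField.adjoin.finiteDimensional hαint
  set M : IntermediateField k Ω := normalClosure k L₀ Ω with hM
  haveI : IsGalois k M := ⟨⟩
  have hαM : α ∈ M := IntermediateField.le_normalClosure L₀ (IntermediateField.mem_adjoin_simple_self k α)
  set αM : M := ⟨α, hαM⟩ with hαMdef
  set L : IntermediateField k M := k⟮αM⟯ with hLdef
  haveI : NumberField M := NumberField.of_module_finite k M
  haveI : NumberField L := NumberField.of_module_finite k L
  haveI : IsGalois L M := IsGalois.tower_top_of_isGalois k L M
  haveI : Module.Finite (𝓞 k) (𝓞 M) := IsIntegralClosure.finite (𝓞 k) k M (𝓞 M)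
  haveI : Module.Finite (𝓞 L) (𝓞 M) := IsIntegralClosure.finite (𝓞 L) L M (𝓞 M)
  haveI : IsScalarTower (𝓞 k) (𝓞 L) (𝓞 M) := IsScalarTower.of_algebraMap_eq fun x ↦
    Subtype.ext (IsScalarTower.algebraMap_apply k L M (x : k))
  set G := M ≃ₐ[k] M
  set H := M ≃ₐ[L] M
  haveI : IsGaloisGroup G (𝓞 k) (𝓞 M) := IsGaloisGroup.of_isFractionRing G (𝓞 k) (𝓞 M) k M
  haveI : IsGaloisGroup H (𝓞 L) (𝓞 M) := IsGaloisGroup.of_isFractionRing H (𝓞 L) (𝓞 M) L M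
  -- ### the primes `P = 𝔓 ∩ 𝓞 M` and `Q = P ∩ 𝓞 L`
  set ι := ringOfIntegersToIntegralClosure (k := k) (Ω := Ω) M with hιdef
  set P : Ideal (𝓞 M) := 𝔓.comap ι with hPdef
  haveI hPprime : P.IsPrime := Ideal.comap_isPrime ι 𝔓
  haveI hPover : P.LiesOver w.asIdeal := by
    constructor
    change w.asIdeal = Ideal.comap (algebraMap (𝓞 k) (𝓞 M)) (Ideal.comap ι 𝔓)
    rw [Ideal.comap_comap, hιdef, ringOfIntegersToIntegralClosure_comp_algebraMap]
    exact Ideal.LiesOver.over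
  have hPne : P ≠ ⊥ := Ideal.ne_bot_of_liesOver_of_ne_bot w.ne_bot P
  set Q : Ideal (𝓞 L) := P.under (𝓞 L) with hQdef
  haveI hPQ : P.LiesOver Q := ⟨rfl⟩
  haveI hQprime : Q.IsPrime := Ideal.IsPrime.under (𝓞 L) P
  haveI hQover : Q.LiesOver w.asIdeal := Ideal.under_liesOver_of_liesOver (𝓞 L) P w.asIdeal
  have hQne : Q ≠ ⊥ := Ideal.ne_bot_of_liesOver_of_ne_bot w.ne_bot Q
  let wQ : HeightOneSpectrum (𝓞 L) := ⟨Q, hQprime, hQne⟩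
  haveI : wQ.asIdeal.LiesOver w.asIdeal := hQover
  -- ### Step 1: every element of the inertia group of `P` in `G` fixes `α`
  have hfix : ∀ g ∈ P.inertia G, g αM = αM := by
    intro g hg
    rw [Ideal.inertia, AddSubgroup.mem_inertia] at hg
    -- profinite set-up for `Gal(Ω/k)` acting on `B`
    letI : TopologicalSpace (integralClosure (𝓞 k) Ω) := ⊥
    haveI : DiscreteTopology (integralClosure (𝓞 k) Ω) := ⟨rfl⟩
    haveI : ContinuousSMul (Ω ≃ₐ[k] Ω) (integralClosure (𝓞 k) Ω) :=
      continuousSMul_iff_stabilizer_isOpen.mpr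
        (Literature.NumberTheory.GaloisRepresentations.stabilizer_integralClosure_isOpen (𝓞 k))
    let N : Subgroup (Ω ≃ₐ[k] Ω) := M.fixingSubgroup
    have hN : IsClosed (N : Set (Ω ≃ₐ[k] Ω)) := IntermediateField.fixingSubgroup_isClosed M
    -- lift `g` to `Ω`
    let g₀ : Ω ≃ₐ[k] Ω := AlgEquiv.liftNormal g Ω
    have hg₀ : ∀ x : M, g₀ (x : Ω) = (g x : Ω) := fun x ↦ AlgEquiv.liftNormal_commutes g Ω x
    -- `g₀` acts as inertia on the `N`-invariants of `B`
    have hg₀inv : ∀ b : integralClosure (𝓞 k) Ω, (∀ m ∈ N, m • b = b) → g₀ • b - b ∈ 𝔓 := by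
      intro b hb
      have hbM : (b : Ω) ∈ M := by
        rw [← InfiniteGalois.fixedField_fixingSubgroup M, IntermediateField.mem_fixedField_iff]
        intro f hf
        have := congrArg Subtype.val (hb f hf)
        rwa [integralClosure.coe_smul] at this
      have hbint : IsIntegral ℤ (⟨(b : Ω), hbM⟩ : M) := by
        rw [← isIntegral_algebraMap_iff (algebraMap M Ω).injective]
        exact isIntegral_trans (R := ℤ) (A := 𝓞 k) (b : Ω) b.2
      set x : 𝓞 M := ⟨⟨(b : Ω), hbM⟩, hbint⟩ with hxdef
      have hbx : b = ι x := Subtype.ext rfl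
      have hgx : g • x - x ∈ P := hg x
      rw [hPdef, Ideal.mem_comap, map_sub] at hgx
      rw [hbx]
      convert hgx using 2
      apply Subtype.ext
      rw [integralClosure.coe_smul, coe_ringOfIntegersToIntegralClosure, coe_ringOfIntegersToIntegralClosure]
      exact hg₀ x
    obtain ⟨m, hm, m', hm', hσ⟩ :=
      Literature.NumberTheory.GaloisRepresentations.exists_mul_mul_mem_inertia N hN 𝔓 g₀ hg₀inv
    -- the lifted inertia element fixes `α`, hence `g` fixes `αM`
    have h1 : (m * g₀ * m') α = α := hI _ hσ
    have hm'α : m' α = α := (IntermediateField.mem_fixingSubgroup_iff _ _).mp hm' α hαM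
    have hgα : g₀ α = (g αM : Ω) := hg₀ αM
    have hmα : m (g₀ α) = g₀ α := by
      rw [hgα]
      exact (IntermediateField.mem_fixingSubgroup_iff _ _).mp hm _ (g αM).2
    rw [AlgEquiv.mul_apply, AlgEquiv.mul_apply, hm'α, hmα, hgα] at h1
    exact Subtype.ext h1
  -- ### Step 2: `#I(P∣Q) = #I(P∣w)` — restriction `Gal(M/L) → Gal(M/k)` is a bijection on inertia groups
  have hres_smul : ∀ (h : H) (b : 𝓞 M), (AlgEquiv.restrictScalars k h : G) • b = h • b := fun _ _ ↦ rfl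
  have hmemH : ∀ h : H, AlgEquiv.restrictScalars k h ∈ P.inertia G ↔ h ∈ P.inertia H := by
    intro h
    rw [Ideal.inertia, Ideal.inertia, AddSubgroup.mem_inertia, AddSubgroup.mem_inertia]
    exact forall_congr' fun b ↦ by rw [hres_smul]
  -- an element of `I(P∣w)` fixes `L = k(αM)` pointwise, hence comes from `Gal(M/L)`
  have hlift : ∀ g ∈ P.inertia G, ∃ h : H, AlgEquiv.restrictScalars k h = g := by
    intro g hg
    have hgL : ∀ x : M, x ∈ L → g x = x := by
      intro x hx
      have hstab : Subgroup.zpowers g ≤ MulAction.stabilizer G αM :=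
        (Subgroup.zpowers_le (G := G)).2 (MulAction.mem_stabilizer_iff.2 (hfix g hg))
      have hle : L ≤ IntermediateField.fixedField (Subgroup.zpowers g) := by
        rw [hLdef, IntermediateField.adjoin_simple_le_iff, IntermediateField.mem_fixedField_iff]
        intro f hf
        exact MulAction.mem_stabilizer_iff.1 (hstab hf)
      exact (IntermediateField.mem_fixedField_iff _ _).1 (hle hx) g (Subgroup.mem_zpowers g)
    refine ⟨{ g with commutes' := fun x ↦ hgL x x.2 }, ?_⟩
    ext x
    rfl
  have hcard : Nat.card (P.inertia H) = Nat.card (P.inertia G) := by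
    refine Nat.card_congr (Equiv.ofBijective (fun h ↦ ⟨AlgEquiv.restrictScalars k h.1, (hmemH h.1).2 h.2⟩) ⟨?_, ?_⟩)
    · rintro ⟨h₁, _⟩ ⟨h₂, _⟩ h12
      exact Subtype.ext (AlgEquiv.restrictScalars_injective k (congrArg Subtype.val h12))
    · rintro ⟨g, hg⟩
      obtain ⟨h, rfl⟩ := hlift g hg
      exact ⟨⟨h, (hmemH h).1 hg⟩, rfl⟩
  -- ### Step 3: `e(Q∣w) = 1`
  haveI := w.isPrime
  have hG : Nat.card (P.inertia G) = P.ramificationIdx (𝓞 k) := by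
    rw [Ideal.card_inertia_eq_ramificationIdxIn (G := G) w.asIdeal P, Ideal.ramificationIdxIn_eq_ramificationIdx w.asIdeal P G]
  have hH : Nat.card (P.inertia H) = P.ramificationIdx (𝓞 L) := by
    rw [Ideal.card_inertia_eq_ramificationIdxIn (G := H) Q P, Ideal.ramificationIdxIn_eq_ramificationIdx Q P H]
  have hpos : 0 < P.ramificationIdx (𝓞 L) := by
    rw [← hH]
    exact Nat.card_pos
  have htower : P.ramificationIdx (𝓞 k) = Q.ramificationIdx (𝓞 k) * P.ramificationIdx (𝓞 L) :=
    Ideal.ramificationIdx_tower Q P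
  have heQ : Q.ramificationIdx (𝓞 k) = 1 := by
    rw [← hG, ← hcard, hH] at htower
    exact (mul_eq_right₀ hpos.ne').1 htower.symm
  have he : w.asIdeal.ramificationIdx' Q = 1 := by
    rw [Ideal.ramificationIdx'_eq_ramificationIdx w.asIdeal Q w.ne_bot, heQ]
  -- ### Step 4: `ord_w(a) = ord_Q(a) = n · ord_Q(α)`
  have hval := HeightOneSpectrum.valuation_liesOver L w wQ a
  rw [he, pow_one] at hval
  let α' : L := AdjoinSimple.gen k αM
  have haL : algebraMap k L a = α' ^ n := by
    apply (algebraMap L M).injective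
    apply (algebraMap M Ω).injective
    rw [map_pow, map_pow, ← IsScalarTower.algebraMap_apply, ← IsScalarTower.algebraMap_apply, ← hα]
    rfl
  rw [hval, haL, map_pow, WithZero.log_pow, nsmul_eq_mul]
  exact Dvd.intro _ rfl

/-! ## The `Γ_K`-internal reading: `F ⊆ K̄` finite over a number field `K`, primes of `\bar ℤ_K`, inertia inside `Γ_K` -/

section AbsoluteBase

open Field Literature.NumberTheory.GaloisRepresentations Literature.NumberTheory.GaloisRepresentations.LocalWeilDatum

variable {K : Type u} [Field K] [NumberField K]

omit [NumberField K] in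
/-- The integral closure of `𝓞 F` in `K̄` maps to `\bar ℤ_K = absIntegers (𝓞 K) K` (same subring of `K̄`: integrality over `𝓞 F`, finite
over `𝓞 K`, is integrality over `𝓞 K`). [folklore] -/
theorem isIntegral_ringOfIntegers_of_mem_integralClosure (F : IntermediateField K (AlgebraicClosure K)) [NumberField F]
    (b : integralClosure (𝓞 F) (AlgebraicClosure K)) : IsIntegral (𝓞 K) (b : AlgebraicClosure K) := by
  have h1 : IsIntegral ℤ (b : AlgebraicClosure K) := isIntegral_trans (R := ℤ) (A := 𝓞 F) (b : AlgebraicClosure K) b.2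
  exact h1.tower_top

/-- **`Γ_K`-internal μ-free unramified Kummer criterion.** `K` a number field, `F ⊆ K̄` a finite extension, `x ∈ Fˣ`, `β ∈ K̄` with
`βⁿ = x` (`0 < n`), `w′` a finite place of `F`, `𝔓` a prime of `\bar ℤ_K = absIntegers (𝓞 K) K` with `𝔓 ∩ 𝓞 F = w′`. If every
`τ ∈ Gal(K̄/F) = galFixing K F` lying in the inertia group `I_𝔓 ≤ Γ_K` fixes `β`, then `n ∣ ord_{w′}(x)`. (Transport of
`dvd_log_valuation_of_inertia_fixes_root_of_normalClosure` for the Galois pair `(F, K̄)` along `toAbsGalHom F : Aut_F(K̄) → Γ_K` and the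
identification of the two integral closures.) [cite: SilvermanAEC2009, Prop. VIII.1.6 (proof)] [cite: SerreLocalFields1979, I §7 Prop. 22 (b)] -/
theorem dvd_log_valuation_of_galFixing_inter_inertia_fixes_root (F : IntermediateField K (AlgebraicClosure K))
    [FiniteDimensional K F] [NumberField F] {n : ℕ} (hn : 0 < n) {x : F}
    {β : AlgebraicClosure K} (hβ : β ^ n = ((x : F) : AlgebraicClosure K)) (w' : HeightOneSpectrum (𝓞 F))
    (𝔓 : Ideal (absIntegers (𝓞 K) K)) [𝔓.IsPrime]
    (h𝔓 : 𝔓.comap (ringOfIntegersToIntegralClosure (k := K) (Ω := AlgebraicClosure K) F) = w'.asIdeal)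
    (hI : ∀ τ : absoluteGaloisGroup K, τ ∈ galFixing K F → τ ∈ 𝔓.inertia (absoluteGaloisGroup K) → τ • β = β) :
    (n : ℤ) ∣ WithZero.log (w'.valuation F x) := by
  classical
  haveI : IsGalois F (AlgebraicClosure K) := ⟨⟩
  -- the comparison of the two integral closures and the prime `𝔓_F` of the `𝓞 F`-integral closure under `𝔓`
  let e : integralClosure (𝓞 F) (AlgebraicClosure K) →+* absIntegers (𝓞 K) K :=
    { toFun := fun b ↦ ⟨(b : AlgebraicClosure K), isIntegral_ringOfIntegers_of_mem_integralClosure F b⟩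
      map_one' := rfl
      map_mul' := fun _ _ ↦ rfl
      map_zero' := rfl
      map_add' := fun _ _ ↦ rfl }
  have he : ∀ b, ((e b : absIntegers (𝓞 K) K) : AlgebraicClosure K) = b := fun _ ↦ rfl
  set 𝔓F : Ideal (integralClosure (𝓞 F) (AlgebraicClosure K)) := 𝔓.comap e with h𝔓F
  haveI : 𝔓F.IsPrime := Ideal.comap_isPrime e 𝔓
  haveI : 𝔓F.LiesOver w'.asIdeal := by
    constructor
    change w'.asIdeal = Ideal.comap (algebraMap (𝓞 F) (integralClosure (𝓞 F) (AlgebraicClosure K))) (Ideal.comap e 𝔓)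
    rw [Ideal.comap_comap, ← h𝔓]
    congr 1
  -- the inertia hypothesis, read on `Aut_F(K̄)`
  refine dvd_log_valuation_of_inertia_fixes_root_of_normalClosure hn hβ w' 𝔓F fun σ hσ ↦ ?_
  rw [Ideal.inertia, AddSubgroup.mem_inertia] at hσ
  have h1 : toAbsGalHom F σ ∈ 𝔓.inertia (absoluteGaloisGroup K) := by
    rw [Ideal.inertia, AddSubgroup.mem_inertia]
    intro b
    let b' : integralClosure (𝓞 F) (AlgebraicClosure K) :=
      ⟨(b : AlgebraicClosure K),
        (isIntegral_trans (R := ℤ) (A := 𝓞 K) (b : AlgebraicClosure K) b.2).tower_top⟩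
    have hb' : e b' = b := Subtype.ext rfl
    have h2 : σ • b' - b' ∈ Ideal.comap e 𝔓 := hσ b'
    rw [Ideal.mem_comap, map_sub, hb'] at h2
    change toAbsGalHom F σ • b - b ∈ 𝔓
    convert h2 using 2
    apply Subtype.ext
    rw [integralClosure.coe_smul]
    change toAbsGalHom F σ • (b : AlgebraicClosure K) = σ (b' : AlgebraicClosure K)
    rw [toAbsGalHom_smul]
  have h3 := hI _ (toAbsGalHom_mem_galFixing F σ) h1
  rwa [toAbsGalHom_smul] at h3

end AbsoluteBase

end Summit.BirchSwinnertonDyer.BirchSwinnertonDyer.Theorems.PrintCf2.KummerU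

end
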